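import Mathlib
import Literature.Computability.AlgebraicComplexity.LandsbergRessayreProofs
import Literature.Computability.AlgebraicComplexity.EquivariantDC
import Summits.ValiantsHypothesis.ValiantsHypothesis.Statement
import Summits.ValiantsHypothesis.ValiantsHypothesis.Theorems.ProjectionStabilityOptStepTwoSidedTorusRestricted
import Summits.ValiantsHypothesis.ValiantsHypothesis.Theorems.FreeSubtorusConfusionCoveringPathWeights
import Summits.ValiantsHypothesis.ValiantsHypothesis.Theorems.FreeSubtorusConfusionCoveringGenericElement
import Summits.ValiantsHypothesis.ValiantsHypothesis.Theorems.FreeSubtorusConfusionCoveringClassCount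

/-!
# `ConfusionCovering` — the rung over the proved floor `SubtorusCovering` (crux dir `OrbitDimensionBound`,
# stmt-ValiantsHypothesis-16133, route FreeSubtorus): PROVED, in tree vocabulary

**Theorem (`confusionCovering`).**  For `n ≥ 3`, let `B` be an affine determinantal representation of `per_n` of
size `m` that is `T_Λ`-equivariant with exact `GL_m × GL_m` lifts, `Λ : Fin r → ([n] ⊔ [n]) → ℤ` admissible
(zero row- and column-sums).  Then some level-`⌊n/2⌋` pair `q = (S, T)` of row/column sets has
`C(n, ⌊n/2⌋) ≤ m · #class(q)`, where `class(q)` is the set of level-`⌊n/2⌋` pairs whose indicator characters are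
congruent to that of `q` modulo `span_ℚ Λ`.  Since `#class(q) ≤ κ_{⌊n/2⌋}(Λ)` (the confusion number of the crux
workfile `Cruxes/OrbitDimensionBound/Lines/ConfusionLadder.lean`, `classCount_le_confusion`), this is the rung
`Summit.ValiantsHypothesis.ValiantsHypothesis.Cruxes.OrbitDimensionBound.Confusion.ConfusionCovering`
(`C(n,⌊n/2⌋) ≤ m · κ_{⌊n/2⌋}(Λ)`) with the Cruxes-local definition `confusion` unfolded — Cruxes modules are not
importable from `Theorems/`, so the two-line bridge `ConfusionCovering_proof` lives next to the ladder file.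
For `Λ` in general position (`κ = 1`) the bound reads `C(n, ⌊n/2⌋) ≤ m`; the floor (`… ≤ m · 2^r`,
`Theorems.FreeSubtorusSubtorusCovering.subtorusCovering_proof`) follows from Odlyzko's lemma `κ ≤ 2^r`.

**Proof** = the composition `ConfusionCovering_of` of the line `Lines/confusion_covering.lean` (adapted verbatim)
fed with the three stubs, all proved in this directory:
`stub_genericElement` (`…GenericElement.lean`), `stub_pathWeights` (`…PathWeights.lean`: the graded Leibniz / flow
argument, valid for subtori), `stub_classCount` (`…ClassCount.lean`).
(0) regularity (von zur Gathen, tree theorem); (1) a generic element `(d, e)` of `T_Λ` (row half of admissibility);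
(2) `diag(d_k e_l)` is a generator of `T_Λ`; (3) its exact lift `(g, h)` on coefficient matrices; (4) the kernel line
of `B₀` carries an eigenvalue `γ₀ ≠ 0` of `h`; (5) path weights at level `⌊n/2⌋`; (6) class count.

**On-path record.**  `confusionCovering_of_valiantsHypothesis : ValiantsHypothesis → (rung, class form)` — the
forward discipline's `S → Rung` lemma, trivial now that the rung is a theorem (the summit is asymptotic and
symmetry-free and implies no fixed-`n` inequality otherwise). [cite: LandsbergRessayre2017, Thm. 2.8, §6]
[cite: Vonzurgathen1987, Thm. 3.1]
-/

open Matrix MvPolynomial Finset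
open Literature.Computability.AlgebraicComplexity LRPencil
open scoped Kronecker

-- the mandated summit-side namespace repeats a component by design (single-problem summit)
set_option linter.dupNamespace false

namespace Summit.ValiantsHypothesis.ValiantsHypothesis.Theorems.FreeSubtorusConfusionCovering

noncomputable section

open Classical in
/-- **The rung `ConfusionCovering`, class form (PROVED).**  For `n ≥ 3`, a `T_Λ`-equivariant (exact lifts) affine
determinantal representation of `per_n` of size `m`, `Λ` admissible, admits a level-`⌊n/2⌋` pair `q` with
`C(n, ⌊n/2⌋) ≤ m · #{level-⌊n/2⌋ pairs confused with q modulo span_ℚ Λ}` (`≤ m · κ_{⌊n/2⌋}(Λ)`).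
Composition of `stub_genericElement`, `stub_pathWeights`, `stub_classCount` along the line `confusion_covering`
(adapted from `Cruxes/OrbitDimensionBound/Lines/confusion_covering.lean`, `ConfusionCovering_of`).
[cite: LandsbergRessayre2017, Thm. 2.8, §6] [cite: Vonzurgathen1987, Thm. 3.1] -/
theorem confusionCovering :
    ∀ n : ℕ, 3 ≤ n → ∀ (m r : ℕ) (Λ : Fin r → (Fin n ⊕ Fin n) → ℤ)
    (B : Matrix (Fin m) (Fin m) (MvPolynomial (Fin n × Fin n) ℂ)),
    (∀ i, (∑ k, Λ i (Sum.inl k)) = 0 ∧ (∑ l, Λ i (Sum.inr l)) = 0) →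
    Literature.Computability.AlgebraicComplexity.IsEquivariantDetRepr
      (Subgroup.closure {γ : Matrix.GeneralLinearGroup (Fin n × Fin n) ℂ |
        ∃ d e : Fin n → ℂˣ, (∀ i, (∏ k, (d k) ^ (Λ i (Sum.inl k))) * (∏ l, (e l) ^ (Λ i (Sum.inr l))) = 1) ∧
          (γ : Matrix (Fin n × Fin n) (Fin n × Fin n) ℂ) = Matrix.diagonal (fun p => (d p.1 : ℂ) * (e p.2 : ℂ))})
      (Literature.Computability.AlgebraicComplexity.perPoly (Fin n) ℂ) B →
    ∃ q : Finset (Fin n) × Finset (Fin n), q.1.card = n / 2 ∧ q.2.card = n / 2 ∧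
      n.choose (n / 2) ≤ m * (univ.filter fun p : Finset (Fin n) × Finset (Fin n) =>
        p.1.card = n / 2 ∧ p.2.card = n / 2 ∧
        ∃ c : Fin r → ℚ, ∀ x : Fin n ⊕ Fin n,
          ((Sum.elim (fun k => if k ∈ p.1 then (1 : ℤ) else 0) (fun l => if l ∈ p.2 then (1 : ℤ) else 0) x : ℤ) : ℚ) -
          ((Sum.elim (fun k => if k ∈ q.1 then (1 : ℤ) else 0) (fun l => if l ∈ q.2 then (1 : ℤ) else 0) x : ℤ) : ℚ)
            = ∑ i, c i * ((Λ i x : ℤ) : ℚ)).card := by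
  intro n hn m r Λ B hΛ hB
  classical
  -- (0) the affine data and regularity (von zur Gathen 1987, Thm. 3.1, proved in the tree)
  have haff : ∀ i j, (B i j).totalDegree ≤ 1 := hB.1.1
  have hdet : B.det = perPoly (Fin n) ℂ := hB.1.2
  have hreg : IsRegularDetRepr (perPoly (Fin n) ℂ) B :=
    hB.isRegular_perPoly vonzurGathen1987_perm_detRepr_rank_holds hn
  -- (1) a generic element `(d, e)` of the subtorus (only the ROW half of admissibility is used)
  obtain ⟨d, e, hrel, hnocyc, hsep⟩ := stub_genericElement n r Λ (fun i => (hΛ i).1)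
  have hc0 : ∀ p : Fin n × Fin n, ((fun p : Fin n × Fin n => (d p.1 : ℂ) * (e p.2 : ℂ)) p) ≠ 0 :=
    fun p => mul_ne_zero (d p.1).ne_zero (e p.2).ne_zero
  have hd0 : ∀ k, ((fun k => (d k : ℂ)) k) ≠ 0 := fun k => (d k).ne_zero
  have he0 : ∀ l, ((fun l => (e l : ℂ)) l) ≠ 0 := fun l => (e l).ne_zero
  -- (2) the torus element `x_{kl} ↦ d_k e_l x_{kl}` = `diag(d) ⊗ diag(e) ∈ GL(n²)`; it is a generator of `T_Λ`
  let γ : GL (Fin n × Fin n) ℂ :=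
    Matrix.GeneralLinearGroup.kronecker (diagUnit ℂ (fun k => (d k : ℂ)) hd0) (diagUnit ℂ (fun l => (e l : ℂ)) he0)
  have hγcoe : (γ : Matrix (Fin n × Fin n) (Fin n × Fin n) ℂ) =
      Matrix.diagonal (fun p : Fin n × Fin n => (d p.1 : ℂ) * (e p.2 : ℂ)) := by
    show Matrix.diagonal _ ⊗ₖ Matrix.diagonal _ = _
    exact Matrix.diagonal_kronecker_diagonal _ _
  have hγmem : γ ∈ Subgroup.closure {γ : Matrix.GeneralLinearGroup (Fin n × Fin n) ℂ |
      ∃ d e : Fin n → ℂˣ, (∀ i, (∏ k, (d k) ^ (Λ i (Sum.inl k))) * (∏ l, (e l) ^ (Λ i (Sum.inr l))) = 1) ∧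
        (γ : Matrix (Fin n × Fin n) (Fin n × Fin n) ℂ) =
          Matrix.diagonal (fun p => (d p.1 : ℂ) * (e p.2 : ℂ))} :=
    Subgroup.subset_closure ⟨d, e, hrel, hγcoe⟩
  -- (3) its exact lift `(g, h)`: `g B₀ = B₀ h` and `g B_p = d_{p.1} e_{p.2} B_p h`
  obtain ⟨g, h, hgh, hΛ0⟩ := hB.exists_lift_stabilising hγmem
  have hAv : ∀ p : Fin n × Fin n, (g : Matrix (Fin m) (Fin m) ℂ) * coeffMat B p =
      ((d p.1 : ℂ) * (e p.2 : ℂ)) • (coeffMat B p * (h : Matrix (Fin m) (Fin m) ℂ)) := by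
    intro p
    have e1 : coeffMat (Matrix.linSubstEntries γ B) p =
        coeffMat ((g : Matrix (Fin m) (Fin m) ℂ).map C * B *
          ((h⁻¹ : GL (Fin m) ℂ) : Matrix (Fin m) (Fin m) ℂ).map C) p := by rw [hgh]
    rw [coeffMat_linSubstEntries _ _ haff, hγcoe, ProjectionStabilityOptStep.TwoSidedTorusRestricted.sum_diagonal_smul,
      coeffMat_C_mul_mul_C] at e1
    rw [mul_eq_of_eq_mul_mul_inv e1, Matrix.smul_mul]
  -- (4) regularity: the kernel of `B₀` is a line, on which `h` has an eigenvalue `γ₀ ≠ 0`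
  set Λm : Matrix (Fin m) (Fin m) ℂ := constPart B with hΛm
  have hK : Module.finrank ℂ (LinearMap.ker (Matrix.toLin' Λm)) = 1 := by
    have h1 := LinearMap.finrank_range_add_finrank_ker (Matrix.toLin' Λm)
    rw [Module.finrank_fin_fun] at h1
    have h2 : Module.finrank ℂ (LinearMap.range (Matrix.toLin' Λm)) = m - 1 := by
      rw [Matrix.toLin'_apply']; exact hreg.2
    have hm : 1 ≤ m := by
      rcases Nat.eq_zero_or_pos m with h0 | h0
      · subst h0
        exfalso
        have h3 : B.det = 1 := Matrix.det_isEmpty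
        have h4 := congrArg constantCoeff hdet
        rw [h3, constantCoeff_perPoly ℂ (by omega : 1 ≤ n), map_one] at h4
        exact one_ne_zero h4
      · exact h0
    omega
  let L : Lift (Matrix.toLin' Λm) (fun _ _ : Fin n => Matrix.toLin' (0 : Matrix (Fin m) (Fin m) ℂ)) 1
      (fun _ => (1 : ℂ)) :=
    liftOfMatrices Λm (fun _ _ => 0) 1 _ (fun _ => one_ne_zero) g h hΛ0 (fun _ _ => by simp)
  obtain ⟨γ₀, hγ₀, hker⟩ := exists_eigenvalue_of_finrank_ker_eq_one _ L.C L.map_ker_eq hK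
  have hker' : LinearMap.ker (Matrix.toLin' (constPart B)) ≤
      Module.End.maxGenEigenspace (Matrix.toLin' (h : Matrix (Fin m) (Fin m) ℂ)) γ₀ := hker
  -- (5) path weights: every permutation is served at every level by a weight of `g`
  have hserved := stub_pathWeights n m B (fun p : Fin n × Fin n => (d p.1 : ℂ) * (e p.2 : ℂ)) g h γ₀ hc0 hnocyc hreg
    hΛ0 hAv hker'
  -- (6) the class count at the middle level `⌊n/2⌋`, with the exact separation (iii)
  exact stub_classCount n m r Λ d e γ₀ (g : Matrix (Fin m) (Fin m) ℂ) hγ₀ hsep fun σ =>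
    hserved σ (n / 2) (by omega) (Nat.div_le_self n 2)

open Classical in
/-- **ON-PATH LEMMA `S → Rung`** for the rung `ConfusionCovering` (class form): the Statement `ValiantsHypothesis`
implies the rung — because the rung is now a theorem (`confusionCovering`); the summit is asymptotic and symmetry-free
and carries no fixed-`n` content of its own.  Registered for structural automation (`aesop` safe rule) so that the
tribunal's forward kernel finds it. [folklore] -/
theorem confusionCovering_of_valiantsHypothesis : _root_.ValiantsHypothesis →
    ∀ n : ℕ, 3 ≤ n → ∀ (m r : ℕ) (Λ : Fin r → (Fin n ⊕ Fin n) → ℤ)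
    (B : Matrix (Fin m) (Fin m) (MvPolynomial (Fin n × Fin n) ℂ)),
    (∀ i, (∑ k, Λ i (Sum.inl k)) = 0 ∧ (∑ l, Λ i (Sum.inr l)) = 0) →
    Literature.Computability.AlgebraicComplexity.IsEquivariantDetRepr
      (Subgroup.closure {γ : Matrix.GeneralLinearGroup (Fin n × Fin n) ℂ |
        ∃ d e : Fin n → ℂˣ, (∀ i, (∏ k, (d k) ^ (Λ i (Sum.inl k))) * (∏ l, (e l) ^ (Λ i (Sum.inr l))) = 1) ∧
          (γ : Matrix (Fin n × Fin n) (Fin n × Fin n) ℂ) = Matrix.diagonal (fun p => (d p.1 : ℂ) * (e p.2 : ℂ))})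
      (Literature.Computability.AlgebraicComplexity.perPoly (Fin n) ℂ) B →
    ∃ q : Finset (Fin n) × Finset (Fin n), q.1.card = n / 2 ∧ q.2.card = n / 2 ∧
      n.choose (n / 2) ≤ m * (univ.filter fun p : Finset (Fin n) × Finset (Fin n) =>
        p.1.card = n / 2 ∧ p.2.card = n / 2 ∧
        ∃ c : Fin r → ℚ, ∀ x : Fin n ⊕ Fin n,
          ((Sum.elim (fun k => if k ∈ p.1 then (1 : ℤ) else 0) (fun l => if l ∈ p.2 then (1 : ℤ) else 0) x : ℤ) : ℚ) -
          ((Sum.elim (fun k => if k ∈ q.1 then (1 : ℤ) else 0) (fun l => if l ∈ q.2 then (1 : ℤ) else 0) x : ℤ) : ℚ)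
            = ∑ i, c i * ((Λ i x : ℤ) : ℚ)).card :=
  fun _ => confusionCovering

end

end Summit.ValiantsHypothesis.ValiantsHypothesis.Theorems.FreeSubtorusConfusionCovering
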